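import Mathlib
import Summits.PneNP.PneNP.Theses.Nc03AvoidResidualCore
import Summits.PneNP.PneNP.Theorems.Nc03AvoidResidualCoreCandStarSplit

/-!
# Route Nc03AvoidResidualCore, crux `CandStarReduction` (X₂) — PROVED

Closing file for `stmt-PneNP-19963` (cell pnp-ideate, route `Nc03AvoidResidualCore` rev 8, rung F-N1b):
**if pure-`CAND` range avoidance at linear stretch is in FP for MATCHING-CLASS instances, then it is in FP for
all pure-`CAND` instances** (`Summit.PneNP.PneNP.Theses.Nc03AvoidResidualCore.CandStarReduction :
CandMatchAvoidLinearFP → CandAvoidLinearFP`), at stretch constant `C′ + 2`.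

The proof is the composition of the helper files `…CandStar*`: parse the input code (`Nc03Reduction.codeFP_toRaw`);
count the tangled outputs; with `≥ 2n+1` of them run the tangled-surplus solver — parallel kill (F1), a maximal
family of pairwise DISJOINT cherries found greedily (forcing the apexes, `…CandCherry.apex_eq_true_of_cherry`),
the cover count `#tangled ≤ 2·#covered`, the affine read-out of the covered outputs and a rank argument over `𝔽₂`
run with the tree's span test (`Nc03Reduction.inSpan`, list Gaussian elimination) — else hand the untangled
outputs, a pure matching-class sub-instance on the same inputs with `≥ m − 2n ≥ C′·n` outputs, to the
hypothesised solver and re-embed its answer (`…CandCherry.not_mem_range_of_untangled`). Everything is ONE `CodeFP`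
program (`codeFP_x2Solver`), hence one `IsPolyTime` string function. (Variant of Algorithm ★ of the cell memo
pnp-ideate-p2/ROUND-3-ADDENDUM-B: disjoint cherries instead of the forcing forest, threshold `2n+1` instead of
`n+1`; the registered birth stubs `stub_cherryStar` / `stub_tangledSplit` are not used.)

Restricted-model (NC⁰₃) range-avoidance rung F-N1b of the PneNP frontier ladder; no bearing on P vs NP.
-/

set_option linter.dupNamespace false -- `Summit.PneNP.PneNP.…`: summit = sub-problem name (D-0017 single-conjunct layout)

namespace Summit.PneNP.PneNP.Theorems

open Literature.Computability.Complexity Nc03Reduction Nc03CandStar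

/-- **The ★-reduction** (`stmt-PneNP-19963`): `CAND`-avoidance at linear stretch in FP for matching-class
instances implies `CAND`-avoidance at linear stretch in FP for all pure instances. -/
theorem candStarReduction_proof : Summit.PneNP.PneNP.Theses.Nc03AvoidResidualCore.CandStarReduction := by
  unfold Theses.Nc03AvoidResidualCore.CandStarReduction Theses.Nc03AvoidResidualCore.CandMatchAvoidLinearFP
    Theses.Nc03AvoidResidualCore.CandAvoidLinearFP LocalAvoidLinearFP
  rintro ⟨C', f₁, hf₁, hspec⟩
  obtain ⟨F, hF, hFspec⟩ := codeFP_x2Solver (f₁ := f₁) hf₁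
  refine ⟨C' + 2, F, (CookBridges.isPolyTime_iff F).2 hF, fun n m I hI hn hm => ?_⟩
  have hout := x2Out_correct I hI (f₁ := f₁) (C' := C') (fun N M J hJ hN hM => hspec N M J hJ hN hM) hn hm
  have h1 : F I.encode = x2Out f₁ (rawOf I) := by
    rw [show I.encode = eIn ⟨n, m, I⟩ from rfl, hFspec]
    show x2Out f₁ (prOfRI (toRaw ⟨n, m, I⟩)) = _
    rw [prOfRI_toRaw]
  have e : readOut m (F I.encode) = fun j : Fin m => (x2Out f₁ (rawOf I)).getD j.val false := by
    funext j
    unfold readOut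
    rw [h1]
  rw [e]
  exact hout

end Summit.PneNP.PneNP.Theorems
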